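import Literature.Barriers.QuantumAdvantage.AaronsonChenTables
import Literature.Computability.Cryptography.InverseCdfSampling
import HarnessLib

/-!
# Aaronson–Chen 2017, Lemma 5.3: the query protocol of the `SampBPP^{TQBF,O}` simulator (semantics)

Support file for the machine half `aaronsonChen2017_lem53_machine` of the named fact
`aaronsonChen2017_lem53` (`AaronsonChenOracle.lean`, `AaronsonChenSimulation.lean`), vendoring

* S. Aaronson, L. Chen, CCC 2017 (arXiv:1612.05903) [AaronsonChen2017], **Lemma 5.3** (p. 21;
  proof pp. 21–23): "For any `SampBQP` oracle algorithm `M`, there is a `SampBPP` oracle algorithm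
  `A` such that … `‖𝒟^M_{x,ε} − 𝒟^A_{x,ε}‖ ≤ ε`"; `A` learns the heavy tails of its own replaced
  run by querying `O` ("we query all `x ∈ {0,1}^{2n}` with `Q(x) ≥ τ`", p. 22; the whole table when
  it is small), "then simulates stage 2 and 3 of `M` straightforwardly. That is, it first takes a
  sample `z` by measuring `|v_{T+1}⟩` in the computational basis, and then outputs `A^output(z)`",
  all its computations being "done in `PSPACE` … with the help of the `TQBF` oracle" (p. 23).

**The protocol.** In the tree's transcript model a `SampBPP^{TQBF ⊕ O}` machine is an adaptive
oracle transducer (`Complexity/AdaptiveFunctions.lean`): a query generator and an output map, both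
in `FP`, reading the machine input `w = ⟨x₀, r⟩` (game input `x₀ = ⟨x, 1^k⟩`, coins `r`) and the
one-bit answers received so far. `A`'s intelligence is delegated to ONE language, the ADVICE
LANGUAGE `advLang` (to be reduced to `TQBF`): rounds alternate between an advice query `0·ρ⟨w, h⟩`
(answered by `TQBF`: the next bit of the ADVICE STREAM) and an `O`-query `1·u`, `u` decoded from the
last `W` advice bits (answered by `O`). The advice stream spells, in fixed-width padded blocks
`0^p 1 u` (`S` slots of width `W` per gate, `Gm` gates), the strings queried at each gate of the
replaced run — so that the `O`-query asked right after a block is complete is the string `u` it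
spells, and its answer bit `[u ∈ O]` lands in the history —, then the bits of the sample `y`
(inverse-CDF selection `invCdfVia` from the Born law of the final state against the coins `r`,
`InverseCdfSampling.lean`), then a padded block spelling `post(y)`, which the output map decodes.
The advice bit is a function of `w` and of the HISTORY `h` only: the replaced run is re-run with
the per-gate tables `tabsOf h` read off the complete, real, positively answered blocks of `h`
(`AaronsonChenTables.lean`: `AcSim.tabRun`), which along the true history are the true tables
`O ∩ K_u` (`tabsOf_hist_eq`, the crux, in `AaronsonChenProtocolProofs.lean`).

**This file** defines the protocol and proves its static structure:

* `AcProto` (the data `F, post, c` and the schedule polynomials `pF, sP`), `AcProto.IsBounded`;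
  the schedule `Wd`, `Sm`, `Gm`, `Wo`, `learnLen`, `advLen` and their polynomial forms
  (`roundsP = 2·advLenP`, the round budget);
* `stageList` (strings queried at stage `n`, earlier gates answered by given tables), `block`,
  `ySample`, `advAt`/`advStream` (the advice stream), `trueTabs`; `blockOf`, `tabsOf`, `advBit`,
  **`advLang`**; the query generator `qSem ρ` and the output map `gSem` as plain string functions;
* PROVED: table independence (`stageList_congr`, `block_congr`, `ySample_congr`), the true tables
  (`tabRun_trueTabs_eq_acSimState`, `mem_trueTabs_iff`: **`trueTabs u = O ∩ ⋃_{n ≤ u} stageList n`**),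
  the schedule bounds under `IsBounded` (`nq_lt_Wd`, `length_gates_le_Gm`, `two_bud_le_Sm`,
  `length_post_lt_Wo`, `length_stageList_le_Sm`), and the layout of the advice stream
  (`advAt_learn`, `drop_take_advStream_eq_block`, `lastN_take_advStream_eq_block`,
  `lastN_advStream_eq_padBlock`).

## Design notes

* Stages are indexed by gate position (a gate symbol is a stage with nothing to query), so that
  "the state before stage `n`" is the tabled run of `gates.take n`; widths and counts are
  polynomials in `|w|` that dominate the true quantities (`IsBounded`), unused slots being all-zero
  dummy blocks (no marker, decoded to `ε`, their `O`-answers ignored by `tabsOf`).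
* `O`-queries are asked after EVERY advice bit (period-2 schedule) so that the query generator
  needs no arithmetic: all but the ones after a complete block are junk, ignored by `tabsOf`.

## References

* [AaronsonChen2017] arXiv:1612.05903, Lemma 5.3 and §5.3 (pp. 21–23), read via
  `lit read arxiv:1612.05903 --pages 19-25`.
* [KnuthTAOCP2] §3.4.1 A (inversion method), as vendored in `InverseCdfSampling.lean`.
-/

noncomputable section

namespace Literature.Barriers.QuantumAdvantage

open MeasureTheory _root_.Computability Matrix Polynomial Literature.Computability.Complexity
  Literature.Computability.Cryptography Literature.Computability.QuantumComplexity

variable {N : ℕ}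

/-! ### The protocol data -/

/-- **The data of the simulator's protocol**: a Clifford+T query-circuit family `F` and a
post-processing `post` (the `SampBQP` algorithm in canonical form), the budget exponent `c` of the
replacement process (`acSimParam`), and two polynomials sizing the fixed query schedule: `pF` (a
bound for the size and the ancilla count of `F`) and `sP` (an output-length bound of `post`).
[cite: AaronsonChen2017, §5.3 (pp. 22–23)] -/
structure AcProto where
  /-- the circuit family -/
  F : QCircuitFamily cliffordT
  /-- the classical post-processing -/
  post : List Bool → List Bool
  /-- the budget exponent of the replacement process -/
  c : ℕ
  /-- size/ancilla bound of the family -/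
  pF : Polynomial ℕ
  /-- output-length bound of the post-processing -/
  sP : Polynomial ℕ

namespace AcProto

variable (P : AcProto)

/-- The polynomials are bounds: `|C_n|, ancillas(n) ≤ pF(n)` and `|post z| ≤ sP(|z|)` (a predicate on
the protocol data, supplied by uniformity of `F` and polynomial time of `post`). [folklore] -/
structure IsBounded (P : AcProto) : Prop where
  /-- the size and the ancilla count of the family are bounded by `pF` -/
  size_le : ∀ n, (P.F.circ n).size ≤ P.pF.eval n ∧ P.F.ancillas n ≤ P.pF.eval n
  /-- the output length of the post-processing is bounded by `sP` -/
  post_le : ∀ z, (P.post z).length ≤ P.sP.eval z.length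

/-- Number of wires of the circuit run on the game input `x₀`. [cite: AaronsonChen2017, §2.2 (p. 12)] -/
def nq (x₀ : List Bool) : ℕ := x₀.length + P.F.ancillas x₀.length

/-- The gate list run on the game input `x₀`. [cite: AaronsonChen2017, §2.2 (p. 12)] -/
def gates (x₀ : List Bool) : List (QGate cliffordT (P.nq x₀)) := (P.F.circ x₀.length).gates

/-- The budget `a = b = (|x₀| + T + 2)^c` of the replacement process (`acSimParam`).
[cite: AaronsonChen2017, §5.3 (p. 22)] -/
def bud (x₀ : List Bool) : ℕ := acSimParam P.c x₀ (P.F.circ x₀.length).oracleQueries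

/-- The initial state `|x₀, 0^m⟩`. [cite: AaronsonChen2017, §2.2 (p. 12)] -/
def v0 (x₀ : List Bool) : QReg (P.nq x₀) → ℂ := basisState (padInput x₀.get (P.F.ancillas x₀.length))

/-- The length `2|x₀| + 2 + |r|` of the machine input `w = ⟨x₀, r⟩` (game input and coins), in which
the schedule is sized. [folklore] -/
def wl (x₀ r : List Bool) : ℕ := (boolPair x₀ r).length

/-- Block width `W(m) = m + pF(m) + 1` (room for a marker and any query tail), `m` the length of the
machine input. [folklore] -/
def Wd (m : ℕ) : ℕ := m + P.pF.eval m + 1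

/-- Slots per stage `S(m) = 2(m + pF(m) + 2)^c ≥ 2a` (at most `a` heavy tails or the `≤ a` entries
of a small table are queried at a gate). [cite: AaronsonChen2017, §5.3 (p. 22)] -/
def Sm (m : ℕ) : ℕ := 2 * (m + P.pF.eval m + 2) ^ P.c

/-- Number of stages `pF(m) ≥ #gates`. [folklore] -/
def Gm (m : ℕ) : ℕ := P.pF.eval m

/-- Output block width `sP(W(m)) + 1`. [folklore] -/
def Wo (m : ℕ) : ℕ := P.sP.eval (P.Wd m) + 1

/-- Length of the learning phase of the advice stream: `Gm · S · W` bits. [folklore] -/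
def learnLen (m : ℕ) : ℕ := P.Gm m * (P.Sm m * P.Wd m)

/-- Total length of the advice stream: learning phase, sample block (`W` bits), output block. [folklore] -/
def advLen (m : ℕ) : ℕ := P.learnLen m + P.Wd m + P.Wo m

/-- Block width as a polynomial. [folklore] -/
def WdP : Polynomial ℕ := X + P.pF + 1

/-- Slots per stage as a polynomial. [folklore] -/
def SmP : Polynomial ℕ := 2 * (X + P.pF + 2) ^ P.c

/-- Output block width as a polynomial. [folklore] -/
def WoP : Polynomial ℕ := P.sP.comp P.WdP + 1

/-- Advice length as a polynomial. [folklore] -/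
def advLenP : Polynomial ℕ := P.pF * (P.SmP * P.WdP) + P.WdP + P.WoP

/-- **The round budget** of the simulator: two rounds (an advice query and an `O`-query) per advice
bit. [folklore] -/
def roundsP : Polynomial ℕ := 2 * P.advLenP

/-- `WdP` evaluates to `Wd`. [folklore] -/
@[simp] theorem eval_WdP (m : ℕ) : P.WdP.eval m = P.Wd m := by simp [WdP, Wd]

/-- `SmP` evaluates to `Sm`. [folklore] -/
@[simp] theorem eval_SmP (m : ℕ) : P.SmP.eval m = P.Sm m := by simp [SmP, Sm]

/-- `WoP` evaluates to `Wo`. [folklore] -/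
@[simp] theorem eval_WoP (m : ℕ) : P.WoP.eval m = P.Wo m := by simp [WoP, Wo, Polynomial.eval_comp]

/-- `advLenP` evaluates to `advLen`. [folklore] -/
@[simp] theorem eval_advLenP (m : ℕ) : P.advLenP.eval m = P.advLen m := by
  simp [advLenP, advLen, learnLen, Gm]

/-- `roundsP` evaluates to `2 · advLen`. [folklore] -/
@[simp] theorem eval_roundsP (m : ℕ) : P.roundsP.eval m = 2 * P.advLen m := by simp [roundsP]

/-! ### Stage lists, blocks and the advice stream -/

/-- **The strings queried at stage `n`** (before the `n`-th gate) of the protocol on the game input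
`x₀`, the earlier query gates being answered by the tables `tabs`. [cite: AaronsonChen2017, §5.3 (p. 22)] -/
def stageList (x₀ : List Bool) (tabs : ℕ → Set (List Bool)) (n : ℕ) : List (List Bool) :=
  match (P.gates x₀)[n]? with
  | none => []
  | some g => AcSim.stageListOf (P.bud x₀) (P.bud x₀) g (AcSim.tabRun tabs ((P.gates x₀).take n) (P.v0 x₀))

/-- **Block `s` of stage `n`** of the advice stream on the machine input `⟨x₀, r⟩`: the padded
block of the `s`-th queried string of stage `n`, or the all-zero dummy block. [folklore] -/
def block (x₀ r : List Bool) (tabs : ℕ → Set (List Bool)) (n s : ℕ) : List Bool :=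
  if h : s < (P.stageList x₀ tabs n).length then
    padBlock (P.Wd (wl x₀ r)) ((P.stageList x₀ tabs n)[s])
  else List.replicate (P.Wd (wl x₀ r)) false

/-- **The sample**: the basis label selected by inverse-CDF sampling (`invCdfVia`, in numeral
order) from the Born law of the final state of the tabled run, against the coins `r` read as a
numeral ("it first takes a sample `z` by measuring `|v_{T+1}⟩` in the computational basis").
[cite: AaronsonChen2017, §5.3 (p. 23)] -/
def ySample (x₀ r : List Bool) (tabs : ℕ → Set (List Bool)) : QReg (P.nq x₀) :=
  invCdfVia (qregEquiv _) (bornPMF (AcSim.tabRun tabs (P.gates x₀) (P.v0 x₀))) r.length (bitsToNat r)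

/-- **The advice stream, bit by bit**: in the learning phase bit `j % W` of block `(j / (S W),
(j % (S W)) / W)`; then the sample `y` as a bit string (padded with zeros to width `W`); then the
padded output block spelling `post(y)` ("and then outputs `A^output(z)` as its output").
[cite: AaronsonChen2017, §5.3 (p. 23)] -/
def advAt (x₀ r : List Bool) (tabs : ℕ → Set (List Bool)) (j : ℕ) : Bool :=
  if j < P.learnLen (wl x₀ r) then
    (P.block x₀ r tabs (j / (P.Sm (wl x₀ r) * P.Wd (wl x₀ r)))
        (j % (P.Sm (wl x₀ r) * P.Wd (wl x₀ r)) / P.Wd (wl x₀ r))).getD (j % P.Wd (wl x₀ r)) false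
  else if j < P.learnLen (wl x₀ r) + P.Wd (wl x₀ r) then
    (List.ofFn (P.ySample x₀ r tabs)).getD (j - P.learnLen (wl x₀ r)) false
  else
    (padBlock (P.Wo (wl x₀ r)) (P.post (List.ofFn (P.ySample x₀ r tabs)))).getD
      (j - P.learnLen (wl x₀ r) - P.Wd (wl x₀ r)) false

/-- The advice stream as a string of length `advLen |w|`. [folklore] -/
def advStream (x₀ r : List Bool) (tabs : ℕ → Set (List Bool)) : List Bool :=
  (List.range (P.advLen (wl x₀ r))).map (P.advAt x₀ r tabs)

/-- **The true tables** against the oracle `O` on the game input `x₀`: stage `u` answers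
`TQBF ⊕ (O ∩ K_u)` (`AcSim.trueTabs` of the process on the family's circuit from `|x₀, 0^m⟩`).
[cite: AaronsonChen2017, §5.3 (p. 22)] -/
def trueTabs (O : Set (List Bool)) (x₀ : List Bool) : ℕ → Set (List Bool) :=
  AcSim.trueTabs O (P.bud x₀) (P.bud x₀) (P.gates x₀) (acSimInit P.F x₀)

/-! ### Reading the tables off a history of answers, and the advice language -/

/-- The advice bits spelling block `s` of stage `n`, read off a history `h` of one-bit answers
(advice answers at even positions). [folklore] -/
def blockOf (x₀ r h : List Bool) (n s : ℕ) : List Bool :=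
  ((evens h).drop ((n * P.Sm (wl x₀ r) + s) * P.Wd (wl x₀ r))).take (P.Wd (wl x₀ r))

/-- **The tables read off a history** `h` of one-bit answers (advice answers at even positions,
`O`-answers at odd positions) on the machine input `⟨x₀, r⟩`: the table of stage `u` collects the
decoded payloads of the COMPLETE (its `O`-answer received), REAL (marker present) blocks of stages
`n ≤ u` whose `O`-answer was `1`. [folklore] -/
def tabsOf (x₀ r h : List Bool) (u : ℕ) : Set (List Bool) :=
  {v | ∃ n s : ℕ, n ≤ u ∧ n < P.Gm (wl x₀ r) ∧ s < P.Sm (wl x₀ r) ∧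
    (n * P.Sm (wl x₀ r) + s + 1) * P.Wd (wl x₀ r) ≤ h.length / 2 ∧
    true ∈ P.blockOf x₀ r h n s ∧
    h.getD (2 * ((n * P.Sm (wl x₀ r) + s + 1) * P.Wd (wl x₀ r)) - 1) false = true ∧
    v = decodePad (P.blockOf x₀ r h n s)}

/-- **The advice bit** requested after the history `h` on the machine input `⟨x₀, r⟩`: bit `|h|/2`
of the advice stream computed with the tables read off `h` (only even rounds ask for advice).
[folklore] -/
def advBit (x₀ r h : List Bool) : Bool :=
  if h.length % 2 = 0 then P.advAt x₀ r (P.tabsOf x₀ r h) (h.length / 2) else false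

/-- **The advice language** `ADV = {⟨⟨x₀, r⟩, h⟩ | advBit x₀ r h = 1}`: everything the simulator
computes — the heavy tails of its own replaced run, the inverse-CDF sample of the final Born law,
the post-processing — packaged as one language, to be decided "with the help of the `TQBF`
oracle". [cite: AaronsonChen2017, §5.3 (p. 23, "all the computations can be done in PSPACE")] -/
def advLang : Language Bool :=
  {z | P.advBit (boolUnpair (boolUnpair z).1).1 (boolUnpair (boolUnpair z).1).2 (boolUnpair z).2 = true}

/-! ### Table independence, the true tables, and the schedule bounds -/

/-- The stage list at gate `n` only consults the tables of the gates before it. [folklore] -/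
theorem stageList_congr (x₀ : List Bool) {tabs tabs' : ℕ → Set (List Bool)} {n : ℕ}
    (h : ∀ u < n, tabs u = tabs' u) : P.stageList x₀ tabs n = P.stageList x₀ tabs' n := by
  unfold stageList
  rw [AcSim.tabRun_congr _ _ fun u hu => h u (lt_of_lt_of_le hu ((List.length_take_le _ _)))]

/-- Blocks only consult the tables of the earlier gates. [folklore] -/
theorem block_congr (x₀ r : List Bool) {tabs tabs' : ℕ → Set (List Bool)} {n : ℕ}
    (h : ∀ u < n, tabs u = tabs' u) (s : ℕ) : P.block x₀ r tabs n s = P.block x₀ r tabs' n s := by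
  unfold block
  rw [P.stageList_congr x₀ h]

/-- The sample only consults the tables of the gates of the circuit. [folklore] -/
theorem ySample_congr (x₀ r : List Bool) {tabs tabs' : ℕ → Set (List Bool)}
    (h : ∀ u < (P.gates x₀).length, tabs u = tabs' u) : P.ySample x₀ r tabs = P.ySample x₀ r tabs' := by
  unfold ySample
  rw [AcSim.tabRun_congr _ _ h]

/-- **The tabled run with the true tables ends in the state `V|x₀, 0^m⟩` of the replaced run**
(`acSimState`). [cite: AaronsonChen2017, §5.3 (p. 23, "V|0⟩^{⊗N}")] -/
theorem tabRun_trueTabs_eq_acSimState (O : Set (List Bool)) (x₀ : List Bool) :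
    AcSim.tabRun (P.trueTabs O x₀) (P.gates x₀) (P.v0 x₀) = acSimState P.F O P.c x₀ :=
  (AcSim.run_vec_eq_tabRun O _ _ _ _).symm

/-- The state before gate `n` of the tabled run with the true tables is that of the replaced run. [folklore] -/
theorem tabRun_trueTabs_take (O : Set (List Bool)) (x₀ : List Bool) (n : ℕ) :
    AcSim.tabRun (P.trueTabs O x₀) ((P.gates x₀).take n) (P.v0 x₀) =
      (AcSim.run O (P.bud x₀) (P.bud x₀) ((P.gates x₀).take n) (acSimInit P.F x₀)).vec :=
  (AcSim.run_take_vec_eq_tabRun O _ _ _ _ n).symm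

/-- **The true table of stage `u` is the set of strings of `O` queried at the stages `n ≤ u`.**
[cite: AaronsonChen2017, §5.3 (p. 22, "g(x) = f_known(x)")] -/
theorem mem_trueTabs_iff (O : Set (List Bool)) (x₀ : List Bool) (u : ℕ) (v : List Bool) :
    v ∈ P.trueTabs O x₀ u ↔ v ∈ O ∧ ∃ n ≤ u, v ∈ P.stageList x₀ (P.trueTabs O x₀) n := by
  have e : v ∈ P.trueTabs O x₀ u ↔ v ∈ O ∧
      v ∈ (AcSim.run O (P.bud x₀) (P.bud x₀) ((P.gates x₀).take (u + 1)) (acSimInit P.F x₀)).known :=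
    Iff.rfl
  rw [e, AcSim.mem_known_run_take_iff]
  simp only [show (acSimInit P.F x₀).known = (∅ : Set (List Bool)) from rfl, Set.mem_empty_iff_false,
    false_or, Nat.lt_succ_iff]
  refine and_congr_right fun _ => exists_congr fun n => and_congr_right fun hn => ?_
  unfold stageList
  rw [P.tabRun_trueTabs_take O x₀ n]
  cases h : (P.gates x₀)[n]? with
  | none => simp
  | some g =>
    simp only [Option.some.injEq, exists_eq_left']
    exact (AcSim.mem_stageListOf_iff _ _ g _ v).symm

/-- The budget is at least `1`. [folklore] -/
theorem one_le_bud (x₀ : List Bool) : 1 ≤ P.bud x₀ :=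
  Nat.one_le_pow _ _ (by omega)

/-- The tabled run from `|x₀, 0^m⟩` is a unit vector (Clifford+T is unitary). [folklore] -/
theorem normSq_tabRun_v0 (x₀ : List Bool) (tabs : ℕ → Set (List Bool)) (gs : List (QGate cliffordT (P.nq x₀))) :
    normSq (AcSim.tabRun tabs gs (P.v0 x₀)) = 1 := by
  rw [AcSim.normSq_tabRun cliffordT_isUnitary_holds]
  exact normSq_basisState _

/-- **At most `2a` strings are queried at a stage.** [cite: AaronsonChen2017, §5.3 (p. 22)] -/
theorem length_stageList_le (x₀ : List Bool) (tabs : ℕ → Set (List Bool)) (n : ℕ) :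
    (P.stageList x₀ tabs n).length ≤ 2 * P.bud x₀ := by
  unfold stageList
  cases (P.gates x₀)[n]? with
  | none => simp
  | some g => exact AcSim.length_stageListOf_le (P.one_le_bud x₀) g (P.normSq_tabRun_v0 x₀ tabs _)

/-- Queried strings are shorter than the number of wires. [folklore] -/
theorem length_lt_of_mem_stageList {x₀ : List Bool} {tabs : ℕ → Set (List Bool)} {n : ℕ} {u : List Bool}
    (h : u ∈ P.stageList x₀ tabs n) : u.length < P.nq x₀ := by
  unfold stageList at h
  cases hg : (P.gates x₀)[n]? with
  | none => simp [hg] at h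
  | some g =>
    simp only [hg] at h
    exact AcSim.length_lt_of_mem_stageListOf h

/-- Beyond the gate list the stages are empty. [folklore] -/
theorem stageList_of_length_le {x₀ : List Bool} (tabs : ℕ → Set (List Bool)) {n : ℕ}
    (h : (P.gates x₀).length ≤ n) : P.stageList x₀ tabs n = [] := by
  unfold stageList
  rw [List.getElem?_eq_none h]

section Bounds

variable {P}

/-- The game input is no longer than the machine input. [folklore] -/
theorem length_le_wl (x₀ r : List Bool) : x₀.length ≤ wl x₀ r := by
  rw [wl, length_boolPair]; omega

/-- **Schedule bound: the number of wires is below the block width.** [folklore] -/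
theorem nq_lt_Wd (hP : P.IsBounded) (x₀ r : List Bool) : P.nq x₀ < P.Wd (wl x₀ r) := by
  have h1 := (hP.size_le x₀.length).2
  have h2 := TM2Iter.eval_mono P.pF (length_le_wl x₀ r)
  unfold nq Wd
  have := length_le_wl x₀ r
  omega

/-- **Schedule bound: the gate list fits in the stages.** [folklore] -/
theorem length_gates_le_Gm (hP : P.IsBounded) (x₀ r : List Bool) : (P.gates x₀).length ≤ P.Gm (wl x₀ r) :=
  ((hP.size_le x₀.length).1).trans (TM2Iter.eval_mono P.pF (length_le_wl x₀ r))

/-- **Schedule bound: twice the budget fits in the slots of a stage.** [folklore] -/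
theorem two_bud_le_Sm (hP : P.IsBounded) (x₀ r : List Bool) : 2 * P.bud x₀ ≤ P.Sm (wl x₀ r) := by
  unfold bud Sm acSimParam
  refine Nat.mul_le_mul_left 2 (Nat.pow_le_pow_left ?_ _)
  have hT : (P.F.circ x₀.length).oracleQueries ≤ P.pF.eval (wl x₀ r) :=
    ((List.length_filter_le _ _).trans (hP.size_le x₀.length).1).trans (TM2Iter.eval_mono P.pF (length_le_wl x₀ r))
  have := length_le_wl x₀ r
  omega

/-- **Schedule bound: the post-processed sample fits in the output block.** [folklore] -/
theorem length_post_lt_Wo (hP : P.IsBounded) (x₀ r : List Bool) {z : List Bool} (hz : z.length ≤ P.nq x₀) :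
    (P.post z).length < P.Wo (wl x₀ r) := by
  have h1 := hP.post_le z
  have h2 := TM2Iter.eval_mono P.sP (hz.trans (nq_lt_Wd hP x₀ r).le)
  unfold Wo
  omega

/-- A stage has at most `S` queried strings. [folklore] -/
theorem length_stageList_le_Sm (hP : P.IsBounded) (x₀ r : List Bool) (tabs : ℕ → Set (List Bool)) (n : ℕ) :
    (P.stageList x₀ tabs n).length ≤ P.Sm (wl x₀ r) :=
  (P.length_stageList_le x₀ tabs n).trans (two_bud_le_Sm hP x₀ r)

end Bounds

/-! ### The structure of the advice stream -/

/-- Blocks have width `W`. [folklore] -/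
@[simp] theorem length_block (x₀ r : List Bool) (tabs : ℕ → Set (List Bool)) (n s : ℕ) :
    (P.block x₀ r tabs n s).length = P.Wd (wl x₀ r) := by
  unfold block
  split_ifs <;> simp

/-- The advice stream has length `advLen`. [folklore] -/
@[simp] theorem length_advStream (x₀ r : List Bool) (tabs : ℕ → Set (List Bool)) :
    (P.advStream x₀ r tabs).length = P.advLen (wl x₀ r) := by
  simp [advStream]

/-- The bits of the advice stream. [folklore] -/
theorem getElem_advStream (x₀ r : List Bool) (tabs : ℕ → Set (List Bool)) {j : ℕ}
    (hj : j < (P.advStream x₀ r tabs).length) : (P.advStream x₀ r tabs)[j] = P.advAt x₀ r tabs j := by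
  simp [advStream]

/-- Prefixes of the advice stream. [folklore] -/
theorem take_advStream (x₀ r : List Bool) (tabs : ℕ → Set (List Bool)) {j : ℕ} (hj : j ≤ P.advLen (wl x₀ r)) :
    (P.advStream x₀ r tabs).take j = (List.range j).map (P.advAt x₀ r tabs) := by
  rw [advStream, ← List.map_take, List.take_range, min_eq_left hj]

/-- A slot of the learning phase ends inside it. [folklore] -/
theorem slot_end_le_learnLen {m n s : ℕ} (hn : n < P.Gm m) (hs : s < P.Sm m) :
    (n * P.Sm m + s + 1) * P.Wd m ≤ P.learnLen m := by
  unfold learnLen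
  calc (n * P.Sm m + s + 1) * P.Wd m ≤ (n * P.Sm m + P.Sm m) * P.Wd m :=
        Nat.mul_le_mul_right _ (by omega)
    _ = (n + 1) * (P.Sm m * P.Wd m) := by ring
    _ ≤ P.Gm m * (P.Sm m * P.Wd m) := Nat.mul_le_mul_right _ (Nat.succ_le_of_lt hn)

/-- The learning phase is a prefix of the advice stream. [folklore] -/
theorem learnLen_le_advLen (m : ℕ) : P.learnLen m ≤ P.advLen m := by
  unfold advLen; omega

/-- **Index arithmetic of the learning phase**: bit `b` of slot `s` of stage `n` sits at position
`(n S + s) W + b` of the advice stream. [folklore] -/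
theorem advAt_learn (x₀ r : List Bool) (tabs : ℕ → Set (List Bool)) {n s b : ℕ}
    (hn : n < P.Gm (wl x₀ r)) (hs : s < P.Sm (wl x₀ r)) (hb : b < P.Wd (wl x₀ r)) :
    P.advAt x₀ r tabs ((n * P.Sm (wl x₀ r) + s) * P.Wd (wl x₀ r) + b) = (P.block x₀ r tabs n s).getD b false := by
  set S := P.Sm (wl x₀ r) with hS
  set W := P.Wd (wl x₀ r) with hW
  have hmul : (n * S + s) * W + W = (n * S + s + 1) * W := by ring
  have hslot := P.slot_end_le_learnLen hn hs
  rw [← hS, ← hW] at hslot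
  have hlt : (n * S + s) * W + b < P.learnLen (wl x₀ r) := by omega
  have hsw : s * W + b < S * W := by
    calc s * W + b < s * W + W := by omega
      _ = (s + 1) * W := by ring
      _ ≤ S * W := Nat.mul_le_mul_right _ (Nat.succ_le_of_lt hs)
  have e1 : ((n * S + s) * W + b) / (S * W) = n :=
    Nat.div_eq_of_lt_le (by rw [mul_comm]; nlinarith) (by rw [Nat.succ_mul, mul_comm n]; nlinarith)
  have e2 : ((n * S + s) * W + b) % (S * W) = s * W + b := by
    rw [show (n * S + s) * W + b = s * W + b + S * W * n by ring, Nat.add_mul_mod_self_left,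
      Nat.mod_eq_of_lt hsw]
  have e3 : (s * W + b) / W = s := Nat.div_eq_of_lt_le (by rw [mul_comm]; omega) (by rw [Nat.succ_mul, mul_comm]; omega)
  have e4 : ((n * S + s) * W + b) % W = b := by
    rw [show (n * S + s) * W + b = b + W * (n * S + s) by ring, Nat.add_mul_mod_self_left, Nat.mod_eq_of_lt hb]
  unfold advAt
  rw [if_pos hlt, ← hS, ← hW, e1, e2, e3, e4]

/-- **The `W` bits of the advice stream at slot `s` of stage `n` spell block `(n, s)`.** [folklore] -/
theorem drop_take_advStream_eq_block (x₀ r : List Bool) (tabs : ℕ → Set (List Bool)) {n s : ℕ}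
    (hn : n < P.Gm (wl x₀ r)) (hs : s < P.Sm (wl x₀ r)) :
    ((P.advStream x₀ r tabs).drop ((n * P.Sm (wl x₀ r) + s) * P.Wd (wl x₀ r))).take (P.Wd (wl x₀ r)) =
      P.block x₀ r tabs n s := by
  have hend := (P.slot_end_le_learnLen hn hs).trans (P.learnLen_le_advLen (wl x₀ r))
  have hend' : (n * P.Sm (wl x₀ r) + s) * P.Wd (wl x₀ r) + P.Wd (wl x₀ r) ≤ P.advLen (wl x₀ r) := by
    have : (n * P.Sm (wl x₀ r) + s) * P.Wd (wl x₀ r) + P.Wd (wl x₀ r) = (n * P.Sm (wl x₀ r) + s + 1) * P.Wd (wl x₀ r) := by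
      ring
    omega
  refine List.ext_getElem (by simp; omega) fun b h₁ h₂ => ?_
  rw [List.getElem_take, List.getElem_drop, getElem_advStream, P.advAt_learn x₀ r tabs hn hs (by simpa using h₂),
    List.getD_eq_getElem?_getD, List.getElem?_eq_getElem h₂, Option.getD_some]

/-- **The last `W` advice bits when slot `s` of stage `n` has just been spelled are block `(n, s)`**
(so the `O`-query asked right after it is the string it spells). [folklore] -/
theorem lastN_take_advStream_eq_block (x₀ r : List Bool) (tabs : ℕ → Set (List Bool)) {n s : ℕ}
    (hn : n < P.Gm (wl x₀ r)) (hs : s < P.Sm (wl x₀ r)) :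
    lastN (P.Wd (wl x₀ r)) ((P.advStream x₀ r tabs).take ((n * P.Sm (wl x₀ r) + s + 1) * P.Wd (wl x₀ r))) =
      P.block x₀ r tabs n s := by
  rw [lastN_take (by rw [length_advStream]
                     exact (P.slot_end_le_learnLen hn hs).trans (P.learnLen_le_advLen _))]
  exact P.drop_take_advStream_eq_block x₀ r tabs hn hs

/-- **The last `Wo` bits of the advice stream are the output block** spelling `post(y)`. [folklore] -/
theorem lastN_advStream_eq_padBlock (x₀ r : List Bool) (tabs : ℕ → Set (List Bool)) :
    lastN (P.Wo (wl x₀ r)) (P.advStream x₀ r tabs) =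
      padBlock (P.Wo (wl x₀ r)) (P.post (List.ofFn (P.ySample x₀ r tabs))) := by
  unfold lastN
  refine List.ext_getElem (by simp [advLen]) fun b h₁ h₂ => ?_
  rw [length_padBlock] at h₂
  rw [List.getElem_drop, getElem_advStream, length_advStream]
  have e : P.advLen (wl x₀ r) - P.Wo (wl x₀ r) + b = P.learnLen (wl x₀ r) + P.Wd (wl x₀ r) + b := by
    unfold advLen; omega
  rw [e]
  unfold advAt
  rw [if_neg (by omega), if_neg (by omega), show P.learnLen (wl x₀ r) + P.Wd (wl x₀ r) + b - P.learnLen (wl x₀ r) -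
      P.Wd (wl x₀ r) = b by omega, List.getD_eq_getElem?_getD, List.getElem?_eq_getElem (by simpa using h₂),
    Option.getD_some]

/-! ### The query generator and the output map (semantics) -/

/-- **The query generator** of the simulator, given a map `ρ` (a Karp reduction of `ADV` to
`TQBF`), on `z = ⟨w, h⟩`: after an even number of answers ask the advice query `0 · ρ z`
(answered by `TQBF`), after an odd number ask the `O`-query `1 · decodePad(last W advice bits)`
(answered by `O`; it is the string just spelled when a block has been completed, and junk —
ignored — otherwise). [cite: AaronsonChen2017, §5.3 (pp. 22–23)] -/
def qSem (ρ : List Bool → List Bool) (z : List Bool) : List Bool :=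
  if (boolUnpair z).2.length % 2 = 0 then false :: ρ z
  else true :: decodePad (lastN (P.Wd (boolUnpair z).1.length) (evens (boolUnpair z).2))

/-- **The output map** of the simulator on `z = ⟨w, h⟩`: decode the output block, the last `Wo`
advice bits. [cite: AaronsonChen2017, §5.3 (p. 23, "outputs A^output(z)")] -/
def gSem (z : List Bool) : List Bool :=
  decodePad (lastN (P.Wo (boolUnpair z).1.length) (evens (boolUnpair z).2))

end AcProto

end Literature.Barriers.QuantumAdvantage

end
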